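import Literature.Computability.Complexity.MurrayWilliams2018Lemma13
import Literature.Computability.Complexity.VerifierPatching
import HarnessLib

/-!
# Verifiers that read a self-clocked prefix of the certificate

Literature / complexity toolkit for the tree's one-constant verifier form of `NTIME`
(`Nondeterministic.lean`: ONE constant `c` bounds both the admissible certificates
`|y| ≤ c · f |x| + c` and the running time). A bespoke nondeterministic machine — the simulation
`N` of Murray–Williams 2018, §5 ("guesses a witness circuit `W` … guesses a `C`-circuit `E` …"),
the machines of the easy witness method, padding arguments — naturally comes as: a NEEDED
certificate length `s(x)`, computable from `x` as a unary clock `x ↦ ⟨x, 1^{s(x)}⟩`; a machine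
`M₀` deciding a relation `R₀ x z` on the pairs `⟨x, z⟩` with `|z| ≤ s(x)` within `τ₂(x)` steps;
and the characterisation `x ∈ L ↔ ∃ z, |z| ≤ s(x) ∧ R₀ x z`. To place `L` in `NTIME f` for a bound
`f` that merely DOMINATES the cost (`τ₁ + τ₂ + s + |x| = O(f)`; `f` need not be time
constructible — the situation of the simulation hypotheses of `MurrayWilliams2018Hierarchy.lean` /
`MurrayWilliams2018LevelSimulation.lean`, whose `f` is arbitrary), the verifier must accept
certificates of every admissible length `≤ c · f |x| + c`: it reads `z = y ↾ s(x)` and discards the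
rest of `y` two symbols per step — the truncating wrapper `truncMapAux` of the clock
(`TruncMapMachine.lean`), exactly as in `NVerifier.exists_transport`
(`MurrayWilliams2018Lemma13.lean`, the special case `s(x) = c · t₁ |x| + c`, `M₀` an old verifier).

* **`mem_NTIME_of_prefixMachine`** — the packaging theorem just described, with the explicit
  constant `10 c + 24`;
* **`mem_NTIME_of_prefixMachine'`** — the same with the cost hypothesis split into its four
  parts;
* **`mem_NTIME_of_prefixMachine_of_le`** — the same when the machine `M₀` and the
  characterisation are only given for the inputs of length `≥ n₀` (the almost-everywhere
  situation of witness circuits): the finitely many short inputs are answered by the hard-wired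
  table `x ↦ [x ∈ L]` through the dispatching machine of `VerifierPatching.lean`
  (`exists_dispatch_machine`), still for an arbitrary dominating `f`.

No notion, definition or named fact is introduced (theorems only).

## References

* S. Arora, B. Barak, *Computational Complexity: A Modern Approach*, CUP 2009, Def. 2.1 and
  §2.1.2 (verifier form of `NTIME`; the verifier ignores the part of the certificate it does not
  need, Thm. 2.6), §1.3 (machine constructions) [AroraBarak2009].
* C. D. Murray, R. R. Williams, *Circuit lower bounds for nondeterministic quasi-polytime: an easy
  witness lemma for NP and NQP*, STOC 2018, §5 (the algorithm `N`) [MurrayWilliams2018].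
-/

namespace Literature.Computability.Complexity

open _root_.Computability Turing

/-- **A language presented by a prefix-reading machine is in `NTIME f` for every dominating `f`.**
Data: a needed certificate length `s x` with a clock `N : x ↦ ⟨x, 1^{s x}⟩` running in `τ₁ x`
steps; a machine `M₀` computing `R₀ x z` on `⟨x, z⟩`, `|z| ≤ s x`, in `τ₂ x` steps; the
characterisation `x ∈ L ↔ ∃ z, |z| ≤ s x ∧ R₀ x z`; and `τ₁ x + τ₂ x + s x + |x| ≤ c · f |x| + c`.
Then `L ∈ NTIME f`: the verifier `truncMapAux N ▸ M₀` with relation `R x y = R₀ x (y ↾ s x)` and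
constant `10 c + 24` (on an admissible `⟨x, y⟩` the wrapper outputs `⟨x, y ↾ s x⟩` within
`τ₁ x + 5 |x| + 2 s x + |y| / 2 + 11` steps, `outputsWithin_truncMapAux_boolPair`). No
constructibility of `f` is needed. [cite: AroraBarak2009, §2.1.2 and Thm. 2.6] -/
theorem mem_NTIME_of_prefixMachine {f : ℕ → ℕ} {L : Language Bool} (s : List Bool → ℕ)
    (R₀ : List Bool → List Bool → Bool) (N M₀ : TM2ComputableAux Bool Bool)
    (τ₁ τ₂ : List Bool → ℕ)
    (hN : ∀ x : List Bool, N.OutputsWithin x (boolPair x (List.replicate (s x) true)) (τ₁ x))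
    (hM₀ : ∀ x z : List Bool, z.length ≤ s x →
      M₀.OutputsWithin (boolPair x z) (encodeBool (R₀ x z)) (τ₂ x))
    (hL : ∀ x : List Bool, x ∈ L ↔ ∃ z : List Bool, z.length ≤ s x ∧ R₀ x z = true)
    (c : ℕ) (hτ : ∀ x : List Bool, τ₁ x + τ₂ x + s x + x.length ≤ c * f x.length + c) :
    L ∈ NTIME f := by
  refine ⟨10 * c + 24, fun x y => R₀ x (y.take (s x)), (truncMapAux N).comp M₀,
    fun x y hy => ?_, fun x => ?_⟩
  · -- running time on an admissible pair
    have h₁ := outputsWithin_truncMapAux_boolPair N (y := y) (hN x)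
    simp only [List.length_replicate] at h₁
    have h₂ := hM₀ x (y.take (s x)) (List.length_take_le _ _)
    have h := TM2ComputableAux.comp_outputsWithin _ _ h₁ h₂
    refine h.mono ?_
    have hτx := hτ x
    set F := f x.length with hF
    have e2 : (10 * c + 24) * F = 10 * (c * F) + 24 * F := by ring
    omega
  · -- correctness
    rw [hL x]
    constructor
    · rintro ⟨z, hz, hR⟩
      refine ⟨z, ?_, ?_⟩
      · have hτx := hτ x
        have e2 : (10 * c + 24) * f x.length = 10 * (c * f x.length) + 24 * f x.length := by ring
        omega
      · show R₀ x (z.take (s x)) = true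
        rwa [List.take_of_length_le hz]
    · rintro ⟨y, -, hR⟩
      exact ⟨y.take (s x), List.length_take_le _ _, hR⟩

/-- The same with the cost hypothesis split: `τ₁, τ₂, s = O(f)` and `|x| = O(f |x|)` separately
(constants merged inside). [cite: AroraBarak2009, §2.1.2 and Thm. 2.6] -/
theorem mem_NTIME_of_prefixMachine' {f : ℕ → ℕ} {L : Language Bool} (s : List Bool → ℕ)
    (R₀ : List Bool → List Bool → Bool) (N M₀ : TM2ComputableAux Bool Bool)
    (τ₁ τ₂ : List Bool → ℕ)
    (hN : ∀ x : List Bool, N.OutputsWithin x (boolPair x (List.replicate (s x) true)) (τ₁ x))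
    (hM₀ : ∀ x z : List Bool, z.length ≤ s x →
      M₀.OutputsWithin (boolPair x z) (encodeBool (R₀ x z)) (τ₂ x))
    (hL : ∀ x : List Bool, x ∈ L ↔ ∃ z : List Bool, z.length ≤ s x ∧ R₀ x z = true)
    (h₁ : ∃ c : ℕ, ∀ x : List Bool, τ₁ x ≤ c * f x.length + c)
    (h₂ : ∃ c : ℕ, ∀ x : List Bool, τ₂ x ≤ c * f x.length + c)
    (hs : ∃ c : ℕ, ∀ x : List Bool, s x ≤ c * f x.length + c)
    (hx : ∃ c : ℕ, ∀ n : ℕ, n ≤ c * f n + c) :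
    L ∈ NTIME f := by
  obtain ⟨c₁, hc₁⟩ := h₁
  obtain ⟨c₂, hc₂⟩ := h₂
  obtain ⟨c₃, hc₃⟩ := hs
  obtain ⟨c₄, hc₄⟩ := hx
  refine mem_NTIME_of_prefixMachine s R₀ N M₀ τ₁ τ₂ hN hM₀ hL (c₁ + c₂ + c₃ + c₄) fun x => ?_
  have e1 := hc₁ x
  have e2 := hc₂ x
  have e3 := hc₃ x
  have e4 := hc₄ x.length
  have e : (c₁ + c₂ + c₃ + c₄) * f x.length =
      c₁ * f x.length + c₂ * f x.length + c₃ * f x.length + c₄ * f x.length := by ring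
  omega

/-! ### Machines correct from a threshold length on -/

/-- **A prefix-reading machine correct on the long inputs presents its language in `NTIME f` for
every dominating `f`.** As `mem_NTIME_of_prefixMachine`, but the machine `M₀` is only required
to compute `R₀ x z` (in `τ₂ x` steps, `|z| ≤ s x`) for `|x| ≥ n₀`, and the characterisation
`x ∈ L ↔ ∃ z, |z| ≤ s x ∧ R₀ x z` only for `|x| ≥ n₀`: the inputs with `|x| < n₀` are answered by
the table `x ↦ [x ∈ L]` (`exists_dispatch_machine`, `VerifierPatching.lean`: dispatching
transducer, then the flag wrapper of `M₀`; overhead `2 |⟨x, z⟩| + 5`), and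
`mem_NTIME_of_prefixMachine` applies to the dispatching machine with the relation
`[x ∈ L]` / `R₀ x z` and cost constant `5 c + 9`. This is the last step of every
"witnesses for all but finitely many lengths" verifier construction in the one-constant form of
`NTIME`, for a bound `f` that need not be time constructible (Murray–Williams 2018, §5;
Arora–Barak 2009, §1.3: finitely many inputs in the finite control).
[cite: AroraBarak2009, §1.3 and §2.1.2] -/
theorem mem_NTIME_of_prefixMachine_of_le {f : ℕ → ℕ} {L : Language Bool} (n₀ : ℕ)
    (s : List Bool → ℕ) (R₀ : List Bool → List Bool → Bool) (N M₀ : TM2ComputableAux Bool Bool)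
    (τ₁ τ₂ : List Bool → ℕ)
    (hN : ∀ x : List Bool, N.OutputsWithin x (boolPair x (List.replicate (s x) true)) (τ₁ x))
    (hM₀ : ∀ x z : List Bool, n₀ ≤ x.length → z.length ≤ s x →
      M₀.OutputsWithin (boolPair x z) (encodeBool (R₀ x z)) (τ₂ x))
    (hL : ∀ x : List Bool, n₀ ≤ x.length →
      (x ∈ L ↔ ∃ z : List Bool, z.length ≤ s x ∧ R₀ x z = true))
    (c : ℕ) (hτ : ∀ x : List Bool, τ₁ x + τ₂ x + s x + x.length ≤ c * f x.length + c) :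
    L ∈ NTIME f := by
  classical
  obtain ⟨M, hMs, hMl⟩ :=
    exists_dispatch_machine n₀ (fun x => L.boolIndicator x) encodeBool M₀
  refine mem_NTIME_of_prefixMachine s
    (fun x z => if x.length < n₀ then L.boolIndicator x else R₀ x z) N M
    τ₁ (fun x => τ₂ x + 2 * (2 * x.length + 2 + s x) + 5) hN (fun x z hz => ?_) (fun x => ?_)
    (5 * c + 9) (fun x => ?_)
  · -- the dispatching machine computes the patched relation
    have hlen : (boolPair x z).length = 2 * x.length + 2 + z.length := length_boolPair _ _
    by_cases hx : x.length < n₀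
    · rw [if_pos hx]
      refine (hMs x z hx).mono ?_
      rw [hlen]
      omega
    · rw [if_neg hx]
      refine (hMl x z _ _ (by omega) (hM₀ x z (by omega) hz)).mono ?_
      rw [hlen]
      omega
  · -- the patched characterisation holds at every length
    by_cases hx : x.length < n₀
    · simp only [if_pos hx]
      have hiff : x ∈ L ↔ L.boolIndicator x = true :=
        Set.mem_iff_boolIndicator (L : Set (List Bool)) x
      exact ⟨fun h => ⟨[], Nat.zero_le _, hiff.1 h⟩, fun ⟨_, _, h⟩ => hiff.2 h⟩
    · simp only [if_neg hx]
      exact hL x (by omega)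
  · -- cost
    have hτx := hτ x
    have e : (5 * c + 9) * f x.length = 5 * (c * f x.length) + 9 * f x.length := by ring
    have hxf : x.length ≤ c * f x.length + c := by omega
    show τ₁ x + (τ₂ x + 2 * (2 * x.length + 2 + s x) + 5) + s x + x.length ≤
      (5 * c + 9) * f x.length + (5 * c + 9)
    omega

end Literature.Computability.Complexity
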